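import Summits.SmoothPoincare4.SmoothPoincare4.Theorems.CongruenceShadowsAgkCor6SufficiencyGeomMarkingDefs
import Mathlib.Analysis.Convex.Contractible

/-!
# Stub `stub_jcdOfCellBasis` of line `lp-by-sphere-system-surgery` for crux `AgkCor6Sufficiency`
(item stmt-SmoothPoincare4-10894, routes `CongruenceShadows` / `GroupTrisection`; lead reshape r6b)

PACKAGING a cell basis at a joint-chart cell into the joint-chart datum `JCD`, plus ONE
construction: the marking `μ : S_g ≃* π₁(F, Φ(1,0))` with `μ ∘ mk = (A ⊆ F)_* ∘ θ`, obtained from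
the tree's `exists_geometric_marking_of_closed_cover_collars` (Seifert–van Kampen for the closed
cover `F = A ∪ D`, `A = F ∖ Φ(B(0,1))`, `D = Φ(B̄(0,1))` a disc, glued along the seam circle
`C = Φ(‖z‖ = 1)`, Hatcher Prop. 1.26 (a)) with the collars `Φ(1 ≤ ‖z‖ < 2)` (tree:
`isStrongDeformationRetractOf_image_sphere_collar`) and `Φ(1/2 < ‖z‖ ≤ 1)` (the OUTWARD radial
deformation `isStrongDeformationRetractOf_sphere_halfOpenAnnulus_outer`, pushed forward along the
embedding `Φ`).  No `sorry`.
-/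

set_option linter.dupNamespace false

noncomputable section

open Set Function ContinuousMap Metric
open scoped Manifold ContDiff Topology

namespace Summit.SmoothPoincare4.SmoothPoincare4.Cruxes.AgkCor6Sufficiency.LpBySphereSystemSurgery

open Literature.Topology.FourManifolds
open Literature.AlgebraicTopology.FundamentalGroup
open Literature.AlgebraicTopology.FundamentalGroup.VanKampen
open Literature.AlgebraicTopology.Homotopy

/-! ## The inner collar of the seam circle (outward radial deformation) -/

section InnerCollar

variable {E : Type*} [NormedAddCommGroup E] [NormedSpace ℝ E]

/-- **The outer sphere is a strong deformation retract of a half-open annulus**: for `0 ≤ a < b`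
the outward radial deformation `(t, z) ↦ ((1 - t) + t b/‖z‖) z` retracts `{a < ‖z‖ ≤ b}` onto
`{‖z‖ = b}` inside itself, fixing the sphere (Hatcher, Algebraic Topology, Ch. 0 p. 2; the
outward twin of the tree's `isStrongDeformationRetractOf_sphere_halfOpenAnnulus`). -/
theorem isStrongDeformationRetractOf_sphere_halfOpenAnnulus_outer {a b : ℝ} (ha : 0 ≤ a)
    (hab : a < b) :
    IsStrongDeformationRetractOf (sphere (0 : E) b) {z : E | a < ‖z‖ ∧ ‖z‖ ≤ b} := by
  have hb : 0 < b := lt_of_le_of_lt ha hab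
  -- the radial deformation and its norm
  set H : ℝ → E → E := fun t z => ((1 - t) + t * (b / ‖z‖)) • z with hH
  have hnorm : ∀ {t : ℝ} {z : E}, t ∈ Icc (0 : ℝ) 1 → a < ‖z‖ →
      ‖H t z‖ = (1 - t) * ‖z‖ + t * b := by
    intro t z ht hz
    have hz0 : 0 < ‖z‖ := lt_of_le_of_lt ha hz
    have hcoef : 0 ≤ (1 - t) + t * (b / ‖z‖) :=
      add_nonneg (by linarith [ht.2]) (mul_nonneg ht.1 (div_nonneg hb.le hz0.le))
    simp only [hH, norm_smul, Real.norm_of_nonneg hcoef]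
    rw [add_mul, mul_assoc, div_mul_cancel₀ b hz0.ne']
  refine IsStrongDeformationRetractOf.of_continuousOn H ?_ ?_ ?_ ?_ ?_
  · -- continuity on `[0, 1] × S` (the norm does not vanish there)
    refine ContinuousOn.smul ?_ continuousOn_snd
    refine (continuousOn_const.sub continuousOn_fst).add (continuousOn_fst.mul
      (continuousOn_const.div (continuous_norm.comp_continuousOn continuousOn_snd) fun p hp => ?_))
    exact (lt_of_le_of_lt ha hp.2.1).ne'
  · -- the half-open annulus is preserved
    intro t ht z hz
    have hn := hnorm ht hz.1
    refine ⟨?_, ?_⟩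
    · rw [hn]
      rcases ht.1.eq_or_lt with h | h
      · rw [← h]
        simpa using hz.1
      · nlinarith [mul_nonneg (sub_nonneg.2 ht.2) (sub_pos.2 hz.1).le, mul_pos h (sub_pos.2 hab)]
    · rw [hn]
      nlinarith [mul_nonneg (sub_nonneg.2 ht.2) (sub_nonneg.2 hz.2)]
  · intro z _
    simp [hH]
  · intro z hz
    have hn := hnorm ⟨zero_le_one, le_rfl⟩ hz.1
    rw [mem_sphere_zero_iff_norm, hn]
    ring
  · intro t _ z _ hzb
    rw [mem_sphere_zero_iff_norm] at hzb
    have hc : (1 - t) + t * (b / ‖z‖) = 1 := by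
      rw [hzb, div_self hb.ne']
      ring
    simp only [hH, hc, one_smul]

variable {X : Type*} [TopologicalSpace X] [T2Space X]

/-- **The inner collar of the seam circle.**  For a continuous injective `Φ : B̄(0,2) ⊂ ℝ² → X`
into a Hausdorff space, `Φ(1/2 < ‖z‖ ≤ 1)` strong deformation retracts onto `Φ(‖z‖ = 1)`: the
outward radial deformation transported along the embedding `Φ` (hypothesis `hsdrD` of
`exists_geometric_marking_of_closed_cover_collars`). -/
theorem isStrongDeformationRetractOf_image_sphere_innerCollar
    (Φ : C(closedBall (0 : EuclideanSpace ℝ (Fin 2)) 2, X)) (hinj : Injective Φ) :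
    IsStrongDeformationRetractOf (Φ '' {z | ‖(z : EuclideanSpace ℝ (Fin 2))‖ = 1})
      (Φ '' {z | 1 / 2 < ‖(z : EuclideanSpace ℝ (Fin 2))‖ ∧
        ‖(z : EuclideanSpace ℝ (Fin 2))‖ ≤ 1}) := by
  have h := (isStrongDeformationRetractOf_sphere_halfOpenAnnulus_outer
    (E := EuclideanSpace ℝ (Fin 2)) (a := 1 / 2) (b := 1) (by norm_num) (by norm_num)).preimage_val
    (W := closedBall (0 : EuclideanSpace ℝ (Fin 2)) 2)
    (fun z hz => mem_closedBall_zero_iff.mpr (hz.2.trans one_le_two))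
  haveI : CompactSpace (closedBall (0 : EuclideanSpace ℝ (Fin 2)) 2) :=
    isCompact_iff_compactSpace.mp (isCompact_closedBall 0 2)
  have hemb : Topology.IsEmbedding Φ := (Φ.continuous.isClosedEmbedding hinj).isEmbedding
  have h' := h.image_of_isEmbedding hemb
  convert h' using 2
  · ext z
    simp
  · ext z
    simp

end InnerCollar

/-! ## The marking of `F = A ∪_C D` from a cell basis -/

section Marking

variable {X : Type} [TopologicalSpace X] [T2Space X]

/-- **The marking of a closed set from a cell basis** (Hatcher, Prop. 1.26 (a), via the tree's
`exists_geometric_marking_of_closed_cover_collars`).  Let `F ⊆ X` be closed in the Hausdorff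
space `X`, `Φ : B̄(0,2) ⊂ ℝ² → X` a chart-like `2`-cell in `F` (`Φ` injective, `Φ(B̄(0,2)) ⊆ F`,
`F ∩ O = Φ(B(0,2))` for an open `O`), `A = F ∖ Φ(B(0,1))` path connected, `x₀ ∈ C = Φ(‖z‖ = 1)`,
`t` a generator of `π₁(C, x₀)` and `θ : F⟨a₁, …, b_g⟩ ≃* π₁(A, x₀)` a free basis with
`θ(r_g) = t` read in `A`.  Then there is a marking `μ : S_g ≃* π₁(F, x₀)` with
`μ ∘ mk = (A ⊆ F)_* ∘ θ`: van Kampen for the closed cover `F = A ∪ Φ(B̄(0,1))` glued along the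
circle `C`, with the collars `Φ(1 ≤ ‖z‖ < 2) = A ∩ O` and `Φ(1/2 < ‖z‖ ≤ 1)`, the disc being
simply connected. -/
theorem exists_marking_of_cell_of_basis {F O : Set X} (hFc : IsClosed F)
    (Φ : C(closedBall (0 : EuclideanSpace ℝ (Fin 2)) 2, X)) (hinj : Injective Φ)
    (hΦF : range Φ ⊆ F) (hO : IsOpen O)
    (hFO : F ∩ O = Φ '' {z | ‖(z : EuclideanSpace ℝ (Fin 2))‖ < 2}) {g : ℕ}
    (hApc : IsPathConnected (F \ Φ '' {z | ‖(z : EuclideanSpace ℝ (Fin 2))‖ < 1})) {x₀ : X}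
    (hx : x₀ ∈ Φ '' {z | ‖(z : EuclideanSpace ℝ (Fin 2))‖ = 1})
    (hCA : Φ '' {z | ‖(z : EuclideanSpace ℝ (Fin 2))‖ = 1} ⊆
      F \ Φ '' {z | ‖(z : EuclideanSpace ℝ (Fin 2))‖ < 1})
    (t : FundamentalGroup ↥(Φ '' {z | ‖(z : EuclideanSpace ℝ (Fin 2))‖ = 1}) ⟨x₀, hx⟩)
    (ht : Subgroup.closure {t} = ⊤)
    (θ : FreeGroup (surfaceGen g) ≃*
      FundamentalGroup ↥(F \ Φ '' {z | ‖(z : EuclideanSpace ℝ (Fin 2))‖ < 1}) ⟨x₀, hCA hx⟩)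
    (hθ : θ (surfaceRelator g) = inclHomOfSubset hCA _ hx (hCA hx) t) :
    ∃ (hxF : x₀ ∈ F) (hAF : F \ Φ '' {z | ‖(z : EuclideanSpace ℝ (Fin 2))‖ < 1} ⊆ F)
      (μ : SurfaceGroup g ≃* FundamentalGroup ↥F ⟨x₀, hxF⟩),
      μ.toMonoidHom.comp (PresentedGroup.mk _) =
        (inclHomOfSubset hAF _ (hCA hx) hxF).comp θ.toMonoidHom := by
  haveI : CompactSpace (closedBall (0 : EuclideanSpace ℝ (Fin 2)) 2) :=
    isCompact_iff_compactSpace.mp (isCompact_closedBall 0 2)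
  have hemb : Topology.IsEmbedding Φ := (Φ.continuous.isClosedEmbedding hinj).isEmbedding
  have hcn : Continuous fun z : closedBall (0 : EuclideanSpace ℝ (Fin 2)) 2 =>
      ‖(z : EuclideanSpace ℝ (Fin 2))‖ := continuous_norm.comp continuous_subtype_val
  -- the pieces `A = F ∖ Φ(B(0,1))` and `D = Φ(B̄(0,1))`, meeting in `C = Φ(‖z‖ = 1)`
  have hA : IsClosed (F \ Φ '' {z | ‖(z : EuclideanSpace ℝ (Fin 2))‖ < 1}) :=
    isClosed_diff_image_ball Φ hFc hinj hO hFO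
  have hD : IsClosed (Φ '' {z | ‖(z : EuclideanSpace ℝ (Fin 2))‖ ≤ 1}) :=
    (((isClosed_le hcn continuous_const).isCompact).image Φ.continuous).isClosed
  have hCD : Φ '' {z | ‖(z : EuclideanSpace ℝ (Fin 2))‖ = 1} ⊆
      Φ '' {z | ‖(z : EuclideanSpace ℝ (Fin 2))‖ ≤ 1} :=
    image_mono fun z hz => le_of_eq hz
  have hC : F \ Φ '' {z | ‖(z : EuclideanSpace ℝ (Fin 2))‖ < 1} ∩
      Φ '' {z | ‖(z : EuclideanSpace ℝ (Fin 2))‖ ≤ 1} ⊆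
      Φ '' {z | ‖(z : EuclideanSpace ℝ (Fin 2))‖ = 1} := by
    rintro x ⟨⟨-, hx1⟩, z, hz1, rfl⟩
    exact ⟨z, le_antisymm hz1 (not_lt.1 fun hlt => hx1 ⟨z, hlt, rfl⟩), rfl⟩
  -- the collar of `C` in `A`: `Φ(1 ≤ ‖z‖ < 2) = A ∩ O`
  have hCAe : Φ '' {z | 1 ≤ ‖(z : EuclideanSpace ℝ (Fin 2))‖ ∧ ‖(z : EuclideanSpace ℝ (Fin 2))‖ < 2} =
      F \ Φ '' {z | ‖(z : EuclideanSpace ℝ (Fin 2))‖ < 1} ∩ O :=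
    (diff_image_ball_inter_eq Φ hinj hFO).symm
  have hCCA := image_sphere_subset_image_collar Φ
  have hsdrA := isStrongDeformationRetractOf_image_sphere_collar Φ hinj
  -- the collar of `C` in `D`: `Φ(1/2 < ‖z‖ ≤ 1) = D ∩ (Φ(‖z‖ ≤ 1/2))ᶜ`
  have hOD : IsOpen (Φ '' {z | ‖(z : EuclideanSpace ℝ (Fin 2))‖ ≤ 1 / 2})ᶜ :=
    (((isClosed_le hcn continuous_const).isCompact).image Φ.continuous).isClosed.isOpen_compl
  have hCDe : Φ '' {z | 1 / 2 < ‖(z : EuclideanSpace ℝ (Fin 2))‖ ∧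
        ‖(z : EuclideanSpace ℝ (Fin 2))‖ ≤ 1} =
      Φ '' {z | ‖(z : EuclideanSpace ℝ (Fin 2))‖ ≤ 1} ∩
        (Φ '' {z | ‖(z : EuclideanSpace ℝ (Fin 2))‖ ≤ 1 / 2})ᶜ := by
    ext x
    constructor
    · rintro ⟨z, ⟨hz1, hz2⟩, rfl⟩
      refine ⟨⟨z, hz2, rfl⟩, ?_⟩
      rintro ⟨w, hw, hwz⟩
      have := hinj hwz
      subst this
      exact absurd hw (not_le.2 hz1)
    · rintro ⟨⟨z, hz1, rfl⟩, hx2⟩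
      exact ⟨z, ⟨lt_of_not_ge fun hle => hx2 ⟨z, hle, rfl⟩, hz1⟩, rfl⟩
  have hCCD : Φ '' {z | ‖(z : EuclideanSpace ℝ (Fin 2))‖ = 1} ⊆
      Φ '' {z | 1 / 2 < ‖(z : EuclideanSpace ℝ (Fin 2))‖ ∧ ‖(z : EuclideanSpace ℝ (Fin 2))‖ ≤ 1} :=
    image_mono fun z hz => by
      simp only [mem_setOf_eq] at hz ⊢
      constructor <;> linarith
  have hsdrD := isStrongDeformationRetractOf_image_sphere_innerCollar Φ hinj
  -- `D` is a disc: simply connected, hence path connected with trivial `π₁`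
  have hDsc : IsSimplyConnected (Φ '' {z | ‖(z : EuclideanSpace ℝ (Fin 2))‖ ≤ 1}) := by
    rw [hemb.isSimplyConnected_image, ← Topology.IsEmbedding.subtypeVal.isSimplyConnected_image]
    have e1 : Subtype.val '' {z : closedBall (0 : EuclideanSpace ℝ (Fin 2)) 2 |
        ‖(z : EuclideanSpace ℝ (Fin 2))‖ ≤ 1} = closedBall (0 : EuclideanSpace ℝ (Fin 2)) 1 := by
      ext w
      constructor
      · rintro ⟨z, hz, rfl⟩
        have hz' : ‖(z : EuclideanSpace ℝ (Fin 2))‖ ≤ 1 := hz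
        exact mem_closedBall_zero_iff.2 hz'
      · intro hw
        have hw' : ‖w‖ ≤ 1 := mem_closedBall_zero_iff.1 hw
        exact ⟨⟨w, closedBall_subset_closedBall one_le_two hw⟩, hw', rfl⟩
    rw [e1]
    haveI := (convex_closedBall (0 : EuclideanSpace ℝ (Fin 2)) 1).contractibleSpace
      ⟨0, mem_closedBall_self zero_le_one⟩
    show SimplyConnectedSpace _
    infer_instance
  have hDpc : IsPathConnected (Φ '' {z | ‖(z : EuclideanSpace ℝ (Fin 2))‖ ≤ 1}) :=
    hDsc.isPathConnected
  have hCpc := isPathConnected_image_sphere Φ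
  haveI : Subsingleton (FundamentalGroup ↥(Φ '' {z | ‖(z : EuclideanSpace ℝ (Fin 2))‖ ≤ 1})
      ⟨x₀, hCD hx⟩) := by
    haveI : SimplyConnectedSpace ↥(Φ '' {z | ‖(z : EuclideanSpace ℝ (Fin 2))‖ ≤ 1}) := hDsc
    infer_instance
  -- `A ∪ D = F`
  have eW₀ : F \ Φ '' {z | ‖(z : EuclideanSpace ℝ (Fin 2))‖ < 1} ∪
      Φ '' {z | ‖(z : EuclideanSpace ℝ (Fin 2))‖ ≤ 1} = F := by
    apply subset_antisymm
    · rintro x (hx' | ⟨z, -, rfl⟩)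
      · exact hx'.1
      · exact hΦF ⟨z, rfl⟩
    · intro x hxF
      by_cases hx' : x ∈ Φ '' {z | ‖(z : EuclideanSpace ℝ (Fin 2))‖ < 1}
      · obtain ⟨z, hz, rfl⟩ := hx'
        have hz' : ‖(z : EuclideanSpace ℝ (Fin 2))‖ ≤ 1 := le_of_lt hz
        exact Or.inr ⟨z, hz', rfl⟩
      · exact Or.inl ⟨hxF, hx'⟩
  -- Seifert–van Kampen (Hatcher 1.26 (a))
  obtain ⟨hxW₀, hAW₀, μ, hμ⟩ := exists_geometric_marking_of_closed_cover_collars hA hD hCA hCD hC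
    hO hCAe hCCA hOD hCDe hCCD hsdrA hsdrD hApc hDpc hCpc hx eW₀ t ht θ hθ
  exact ⟨hxW₀, hAW₀, μ, hμ⟩

end Marking

/-! ## The stub -/

/-- **Stub `stub_jcdOfCellBasis`** (registered signature of skeleton r6b): a cell basis
`CellBasis (⋂ m, S m) Φ g` at a joint-chart cell `(Θ, i, j, l, ρ, Φ, O)` of a Gay–Kirby
trisection packages, together with the van Kampen marking `μ` of
`exists_marking_of_cell_of_basis` (`μ ∘ mk = (A ⊆ F)_* ∘ θ`), into the joint-chart datum
`JCD X g S ⟨Φ(1,0), _⟩ μ`. -/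
theorem stub_jcdOfCellBasis {X : Type} [TopologicalSpace X] [T2Space X]
    [ChartedSpace (EuclideanSpace ℝ (Fin 4)) X] {g : ℕ} {k : Fin 3 → ℕ} {S : Fin 3 → Set X}
    (h : IsGKTrisection X g k S)
    (Θ : OpenPartialHomeomorph X (EuclideanSpace ℝ (Fin 4))) (i j l : Fin 3) (ρ : ℝ)
    (Φ : C(closedBall (0 : EuclideanSpace ℝ (Fin 2)) 2, X)) (O : Set X)
    (hΘ : Θ ∈ IsManifold.maximalAtlas (𝓡 4) ∞ X) (hji : j ≠ i) (hli : l ≠ i) (hlj : l ≠ j)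
    (hSi : ∀ y ∈ Θ.source, y ∈ S i ↔ (0 ≤ Θ y 0 ∧ 0 ≤ Θ y 1))
    (hF : ∀ y ∈ Θ.source, y ∈ (⋂ m, S m) ↔ (Θ y 0 = 0 ∧ Θ y 1 = 0))
    (hSj : ∀ y ∈ Θ.source, y ∈ S j ↔ (Θ y 0 ≤ 0 ∧ Θ y 0 ≤ Θ y 1))
    (hSl : ∀ y ∈ Θ.source, y ∈ S l ↔ (Θ y 1 ≤ 0 ∧ Θ y 1 ≤ Θ y 0))
    (hρ : 0 < ρ) (hsrc : ∀ z, Φ z ∈ Θ.source)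
    (hΘΦ : ∀ z, Θ (Φ z) =
      !₂[0, 0, ρ * (z : EuclideanSpace ℝ (Fin 2)) 0, ρ * (z : EuclideanSpace ℝ (Fin 2)) 1])
    (hinj : Injective Φ) (hΦF : range Φ ⊆ ⋂ m, S m) (hO : IsOpen O) (hOsrc : O ⊆ Θ.source)
    (hOeq : O = {y | y ∈ Θ.source ∧ ‖(!₂[Θ y 2, Θ y 3] : EuclideanSpace ℝ (Fin 2))‖ < 2 * ρ})
    (hFO : (⋂ m, S m) ∩ O = Φ '' {z | ‖(z : EuclideanSpace ℝ (Fin 2))‖ < 2})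
    (hB : CellBasis (⋂ m, S m) Φ g) :
    ∃ μ : SurfaceGroup g ≃* FundamentalGroup (centralSurface S) ⟨Φ cellPt, hΦF ⟨cellPt, rfl⟩⟩,
      JCD X g S ⟨Φ cellPt, hΦF ⟨cellPt, rfl⟩⟩ μ := by
  unfold CellBasis cellHole cellCircle at hB
  obtain ⟨hApc, hx, hCA, t, θ, ht, hθ⟩ := hB
  obtain ⟨hxF, hAF, μ, hμ⟩ := exists_marking_of_cell_of_basis h.isCompact_iInter.isClosed Φ hinj
    hΦF hO hFO hApc hx hCA t ht θ hθ
  exact ⟨μ, Θ, i, j, l, ρ, Φ, O, hΘ, hji, hli, hlj, hSi, hF, hSj, hSl, hρ, hsrc, hΘΦ, hinj, hΦF,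
    hO, hOsrc, hOeq, hFO, rfl, hApc, hx, hCA, hAF, t, θ, ht, hθ, hμ⟩

end Summit.SmoothPoincare4.SmoothPoincare4.Cruxes.AgkCor6Sufficiency.LpBySphereSystemSurgery

end
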